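import Summits.MatrixMultiplication.OmegaCensus.STPPVosperSlackOneTools

/-!
# ω-census (abelian STPP census): the SLACK-1 VOSPER LAW at prime order, modulo the Hamidoune–Rødseth inverse theorem — statement of the inverse theorem and the transport steps (kernel)

HONEST FRAMING (pub-omega census; verbatim): lottery ticket; floor = certified bounds/negative ranges.
Census STRUCTURE (seat pub-omega-stpp-1 gen 30, 2026-08-28), family (b2).  The successor of the N18-tight table laws
(`STPPVosperPrimeTableLaw.lean`, `STPPVosperTableLaw.lean`): a THEOREM FILTER for residual patterns of a PRIME order `p` whose best N18 chain
has slack ONE.  It is CONDITIONAL on a published inverse theorem that the tree does not yet prove — the Hamidoune–Rødseth theorem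
(`HamidouneRodsethInverseTheorem`, stated below as printed) — and is labelled so wherever it is used.  Nothing here is progress on `ω`.
THIS FILE: the statement of the inverse theorem, the shared small steps, the blocks of `W`, the prefix law in a window (cases γ, α) and the
holed-window/gapped-tiles transport (case β); the law itself is assembled in `STPPVosperSlackOneLaw.lean`.

## Statement of the law (`no_isSTPP_of_slack_one_tables_prime`, next file)

Notation of `STPPVosperTightStructure.lean` (`C`-reading of block `i` of an STPP family with non-empty sets in `ℤ/pℤ`): `a = |Aᵢ|`, `b = |Bᵢ|`,
`vol = aᵢbᵢcᵢ`, `z = |Z°| = Σ_{k≠i} a_k c_k`, `L = |Y°| = Σ_{k≠i} b_k c_k`, `W = {c − x − y}`, `V = W ⊔ ((−Aᵢ) + Y°)`, `Bᵢ + V ⊆ H ∖ Z°`.  The N18 chain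
`z + b + vol + a + L − 2 ≤ p` is the sum of three inequalities: Cauchy–Davenport for `(−Aᵢ, Y°)`, Cauchy–Davenport for `(Bᵢ, V)`, and the
inclusion.  Suppose the chain has SLACK ONE, `z + b + vol + a + L = p + 1`, with `a, b ≥ 3` and `z, L ≥ 4`; put `m = a + L − 1`, `n = vol + m`
(so `z + b + n = p`).  Exactly one of the three inequalities is loose, by one:

* (γ) the inclusion is loose: both pairs are critical, Vosper twice (`vosper_inverse`), and the TIGHT-type window table for `(n, m, b)` applies verbatim;
* (α) `|(−Aᵢ) + Y°| = a + L`: Hamidoune–Rødseth puts `−Aᵢ`, `Y°` inside progressions of `a + 1`, `L + 1` terms with one common difference `d`, so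
  `(−Aᵢ) + Y°` is an `(m+2)`-term progression WITH ONE TERM REMOVED; the pair `(Bᵢ, V)` is critical with `Bᵢ + V = H ∖ Z°`, Vosper makes `Bᵢ`, `V`
  progressions of step `e′` (`|V| = n + 1`); transported to the window `{0,…,n}` the blocks of `W` are `b`-runs and the case-α table
  (`tableAlpha p (n+1) (m+2) b`) applies;
* (β) `|Bᵢ + V| = b + |V|`: the first pair is critical (Vosper: `Aᵢ`, `Y°`, `(−Aᵢ)+Y°` progressions of step `d`, `|V| = n`), and Hamidoune–Rødseth
  puts `Bᵢ` inside a `(b+1)`-term and `V` inside an `(n+1)`-term progression of step `e′`; transported, the window `{0,…,n}` has ONE HOLE, the blocks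
  of `W` are translates of `{0,…,b}` minus one point, and the greedy tiling test of the case-β table (`tableBeta p (n+1) m b`) applies.

In each case the table forces `e′⁻¹ d ∈ {0, ±1}`, i.e. `d = ±e′`, and two consecutive terms of `Aᵢ` (step `d`; they exist because `a ≥ 3` even
when one term is removed) and of `Bᵢ` (step `e′`, `b ≥ 3`) give a forbidden word `(s′ − s) + (t′ − t) + (γ − γ) = 0` at `(i,i,i)`.

The hypotheses of Hamidoune–Rødseth are met: in (α) `|−Aᵢ| = a ≥ 3`, `|Y°| = L ≥ 4`, `7 ≤ a + L = m + 1 ≤ p − 4` (`= p − z − b − vol + …`);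
in (β) `|Bᵢ| = b ≥ 3`, `|V| = n ≥ 6`, `7 ≤ b + n = p − z ≤ p − 4`.

References: Y. O. Hamidoune, Ø. J. Rødseth, *An inverse theorem mod p*, Acta Arith. 92 (2000) 251–262; O. Serra, G. Zémor, *On a generalization
of a theorem by Vosper*, Integers 0 (2000) A10, Theorem 3 (the statement of Hamidoune–Rødseth used here, verbatim); A. G. Vosper, J. London Math.
Soc. 31 (1956); M. B. Nathanson, GTM 165, Thm 2.7; H. Cohn, R. Kleinberg, B. Szegedy, C. Umans, FOCS 2005 (arXiv:math/0511460), Def. 5.1.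
-/

open Finset
open scoped Pointwise

namespace Summit.MatrixMultiplication.OmegaCensus.CubeNB

open Literature.Computability.AlgebraicComplexity
open Literature.Combinatorics.Additive
open Summit.MatrixMultiplication.OmegaCensus.STPPKneser

/-- **The Hamidoune–Rødseth inverse theorem mod `p`** (Hamidoune–Rødseth 2000, the theorem of the title; restated verbatim as Theorem 3 of
Serra–Zémor 2000: "Let `S` and `T` be subsets of a group of prime order `p`, such that `|S| ≥ 3`, `|T| ≥ 3`, `7 ≤ |S + T| ≤ p − 4`.  Then either
`|S + T| ≥ |S| + |T| + 1`, or `S` and `T` are contained in arithmetic progressions with the same difference and `|S| + 1` and `|T| + 1` elements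
respectively."; zbMATH 0945.11003 / 1067.11003 in Hamidoune's own words: "`3 ≤ |A|`, `4 ≤ |B|` and `|A + B| = |A| + |B| ≤ p − 4` ⇒ `A` (resp. `B`) can
be obtained from an arithmetic progression by deleting one element").  In the tree's vocabulary `apFinset a d n = {a + i•d : i < n}` of `Vosper.lean`;
NOT proved in the tree (the paper's proof is an elementary ten-page case analysis with the Davenport transform).
[cite: HamidouneRodseth2000, main theorem (§1, p. 252)] [cite: SerraZemor2000, Theorem 3 (p. 2)] [file Combinatorics/Additive/HamidouneRodsethInverseTheorem] -/
def HamidouneRodsethInverseTheorem : Prop :=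
  ∀ (p : ℕ) [Fact p.Prime] (S T : Finset (ZMod p)), 3 ≤ #S → 3 ≤ #T → 7 ≤ #(S + T) → #(S + T) ≤ p - 4 → #(S + T) ≤ #S + #T →
    ∃ d s t : ZMod p, S ⊆ apFinset s d (#S + 1) ∧ T ⊆ apFinset t d (#T + 1)

variable {p : ℕ} [hp : Fact p.Prime] {N : ℕ} {A B C : Fin N → Finset (ZMod p)}

/-! ## Small shared steps -/

/-- From `(e′⁻¹·d).val ∈ {0, 1, p − 1}` with `d, e′ ≠ 0`: `d = e′` or `d = −e′`. [folklore] -/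
theorem eq_or_eq_neg_of_ratio_val_mem {d e' : ZMod p} (hd : d ≠ 0) (he' : e' ≠ 0)
    (hval : (e'⁻¹ * d).val ∈ ({0, 1, p - 1} : Finset ℕ)) : d = e' ∨ d = -e' := by
  have hp1 : ((p - 1 : ℕ) : ZMod p) = -1 := by
    rw [Nat.cast_sub hp.out.one_le, Nat.cast_one, ZMod.natCast_self, zero_sub]
  have hee : e' * (e'⁻¹ * d) = d := by rw [← mul_assoc, mul_inv_cancel₀ he', one_mul]
  simp only [Finset.mem_insert, Finset.mem_singleton] at hval
  rcases hval with h0 | h1 | h2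
  · exact absurd ((ZMod.val_eq_zero _).1 h0) (mul_ne_zero (inv_ne_zero he') hd)
  · left
    have h : (((e'⁻¹ * d).val : ℕ) : ZMod p) = ((1 : ℕ) : ZMod p) := by rw [h1]
    rw [ZMod.natCast_zmod_val, Nat.cast_one] at h
    rw [← hee, h, mul_one]
  · right
    have h : (((e'⁻¹ * d).val : ℕ) : ZMod p) = ((p - 1 : ℕ) : ZMod p) := by rw [h2]
    rw [ZMod.natCast_zmod_val, hp1] at h
    rw [← hee, h, mul_neg, mul_one]

/-- **The forbidden word.**  Consecutive terms `α, α + d ∈ Aᵢ` and `β, β + e′ ∈ Bᵢ` with `d = ±e′ ≠ 0` violate the triple product property of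
block `i` (word `(s′ − s) + (t′ − t) + (γ − γ) = 0` at `(i,i,i)`). [cite: CohnKleinbergSzegedyUmans2005, Def. 5.1] -/
theorem false_of_adjacent_steps (hS : IsSTPP A B C) (i : Fin N) {α β d e' : ZMod p} (hα : α ∈ A i) (hαd : α + d ∈ A i)
    (hβ : β ∈ B i) (hβe : β + e' ∈ B i) (hγ : (C i).Nonempty) (he' : e' ≠ 0) (hpm : d = e' ∨ d = -e') : False := by
  obtain ⟨γ, hγ⟩ := hγ
  rcases hpm with h | h
  · have hrel : (α - (α + d)) + ((β + e') - β) + (γ - γ) = 0 := by rw [h]; ring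
    obtain ⟨-, -, -, h4, -⟩ := hS i i i (α + d) hαd α hα β hβ (β + e') hβe γ hγ γ hγ hrel
    exact he' (by linear_combination h4.symm)
  · have hrel : ((α + d) - α) + ((β + e') - β) + (γ - γ) = 0 := by rw [h]; ring
    obtain ⟨-, -, -, h4, -⟩ := hS i i i α hα (α + d) hαd β hβ (β + e') hβe γ hγ γ hγ hrel
    exact he' (by linear_combination h4.symm)

/-- A progression of difference `0` has at most one element; so a set with `≥ 2` elements inside `apFinset s d k` has `d ≠ 0`. [folklore] -/
theorem step_ne_zero_of_subset_apFinset {S : Finset (ZMod p)} {s d : ZMod p} {k : ℕ} (hS : S ⊆ apFinset s d k) (h2 : 2 ≤ #S) : d ≠ 0 := by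
  intro hd
  have hsub : S ⊆ {s} := by
    intro x hx
    obtain ⟨i, -, rfl⟩ := mem_apFinset.1 (hS hx)
    rw [hd, nsmul_zero, add_zero, Finset.mem_singleton]
  have := (Finset.card_le_card hsub).trans (Finset.card_singleton s).le
  omega

/-! ## The blocks of `W` -/

/-- `W = {c − x − y}` is the union over `(x,c) ∈ Aᵢ × Cᵢ` of the blocks `(c − x) − Bᵢ`, and these blocks are PAIRWISE DISJOINT (triple product
property of block `i`). [cite: CohnKleinbergSzegedyUmans2005, Def. 5.1] -/
theorem W_eq_biUnion_blocks (hS : IsSTPP A B C) (i : Fin N) :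
    (((A i) ×ˢ ((B i) ×ˢ (C i))).image fun q : ZMod p × ZMod p × ZMod p => (0 : ZMod p) + q.2.2 - q.1 - q.2.1) =
      ((A i) ×ˢ (C i)).biUnion (fun xc => (B i).image fun y => (xc.2 - xc.1) - y) ∧
    (((A i) ×ˢ (C i) : Finset (ZMod p × ZMod p)) : Set (ZMod p × ZMod p)).PairwiseDisjoint
      (fun xc => (B i).image fun y => (xc.2 - xc.1) - y) := by
  constructor
  · ext x
    simp only [Finset.mem_image, Finset.mem_product, Finset.mem_biUnion, Prod.exists]
    constructor
    · rintro ⟨x₁, y, c, ⟨hx₁, hy', hc⟩, rfl⟩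
      exact ⟨x₁, c, ⟨hx₁, hc⟩, y, hy', by abel⟩
    · rintro ⟨x₁, c, ⟨hx₁, hc⟩, y, hy', rfl⟩
      exact ⟨x₁, y, c, ⟨hx₁, hy', hc⟩, by abel⟩
  · rintro ⟨x₁, c⟩ hxc ⟨x₁', c'⟩ hxc' hne
    rw [Function.onFun, Finset.disjoint_left]
    intro x hx hx'
    obtain ⟨y, hy', rfl⟩ := Finset.mem_image.1 hx
    obtain ⟨y', hy'', hyy⟩ := Finset.mem_image.1 hx'
    have h1 := Finset.mem_product.1 (Finset.mem_coe.1 hxc)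
    have h2 := Finset.mem_product.1 (Finset.mem_coe.1 hxc')
    have hrel : (x₁' - x₁) + (y' - y) + (c - c') = 0 := by
      have h : c' - x₁' - y' = c - x₁ - y := hyy
      linear_combination (-1 : ZMod p) * h
    obtain ⟨-, -, h3, -, h5⟩ := hS i i i x₁ h1.1 x₁' h2.1 y hy' y' hy'' c' h2.2 c h1.2 hrel
    exact hne (Prod.ext h3 h5.symm)

/-! ## The prefix law when `Bᵢ` is a progression and `V` a window (cases γ and α) -/

/-- **Runs in a window.**  If `Bᵢ = {β + k e′ : k ≤ b′}` (`e′ ≠ 0`) and `V = W ⊔ SY` is the `N₁`-term progression of step `e′` from `v`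
(`N₁ + b′ ≤ p`), then after the transport `x ↦ e′⁻¹(x − v)` the set `SY` lands inside the window `{0,…,N₁−1}` and satisfies the PREFIX LAW
`(b′+1) ∣ x.val − #{y ∈ SY′ : y.val < x.val}` at each of its points (the complement in the window being a disjoint union of `(b′+1)`-runs).
[folklore] -/
theorem prefix_law_of_runs (hS : IsSTPP A B C) (i : Fin N) {e' β v : ZMod p} {b' N₁ : ℕ} (he' : e' ≠ 0)
    (hβ : B i = apFinset β e' (b' + 1)) {SY : Finset (ZMod p)}
    (hWV : Disjoint ((((A i) ×ˢ ((B i) ×ˢ (C i))).image fun q : ZMod p × ZMod p × ZMod p => (0 : ZMod p) + q.2.2 - q.1 - q.2.1)) SY)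
    (hv : (((A i) ×ˢ ((B i) ×ˢ (C i))).image fun q : ZMod p × ZMod p × ZMod p => (0 : ZMod p) + q.2.2 - q.1 - q.2.1) ∪ SY = apFinset v e' N₁)
    (hN : N₁ + b' ≤ p) :
    SY.image (fun x => e'⁻¹ * x + -(e'⁻¹ * v)) ⊆ apFinset 0 1 N₁ ∧
      ∀ x ∈ SY.image (fun x => e'⁻¹ * x + -(e'⁻¹ * v)),
        (b' + 1) ∣ x.val - #((SY.image (fun x => e'⁻¹ * x + -(e'⁻¹ * v))).filter fun y => y.val < x.val) := by
  set W := ((A i) ×ˢ ((B i) ×ˢ (C i))).image fun q : ZMod p × ZMod p × ZMod p => (0 : ZMod p) + q.2.2 - q.1 - q.2.1 with hW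
  obtain ⟨hWeq0, hPdisj0⟩ := W_eq_biUnion_blocks hS i
  rw [← hW] at hWeq0
  set P := (A i) ×ˢ (C i) with hP
  have hblk : ∀ xc : ZMod p × ZMod p,
      (B i).image (fun y => (xc.2 - xc.1) - y) = apFinset (xc.2 - xc.1 - β - b' • e') e' (b' + 1) := by
    intro xc; rw [hβ, image_sub_apFinset]
  have hWeq : W = P.biUnion fun xc => apFinset (xc.2 - xc.1 - β - b' • e') e' (b' + 1) := by
    rw [hWeq0]; exact Finset.biUnion_congr rfl fun xc _ => hblk xc
  have hPdisj : (P : Set (ZMod p × ZMod p)).PairwiseDisjoint fun xc => apFinset (xc.2 - xc.1 - β - b' • e') e' (b' + 1) := by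
    intro xc hxc xc' hxc' hne
    rw [Function.onFun, ← hblk, ← hblk]
    exact hPdisj0 hxc hxc' hne
  -- transport
  set u : ZMod p := e'⁻¹ with hu
  set w : ZMod p := -(u * v) with hw
  have hu0 : u ≠ 0 := inv_ne_zero he'
  have hue : u * e' = 1 := inv_mul_cancel₀ he'
  have hφinj : Function.Injective (fun x : ZMod p => u * x + w) := affine_injective hu0 w
  have hφV : (apFinset v e' N₁).image (fun x => u * x + w) = apFinset 0 1 N₁ := by
    rw [image_affine_apFinset, hue, hw, add_neg_cancel]
  set g : ZMod p × ZMod p → ZMod p := fun xc => u * (xc.2 - xc.1 - β - b' • e') + w with hg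
  have hφblk : ∀ xc : ZMod p × ZMod p,
      (apFinset (xc.2 - xc.1 - β - b' • e') e' (b' + 1)).image (fun x => u * x + w) = apFinset (g xc) 1 (b' + 1) := by
    intro xc; rw [image_affine_apFinset, hue]
  set T := W.image (fun x => u * x + w) with hT
  have hTeq : T = P.biUnion fun xc => apFinset (g xc) 1 (b' + 1) := by
    rw [hT, hWeq, Finset.biUnion_image]
    exact Finset.biUnion_congr rfl fun xc _ => hφblk xc
  have hTdisj : (P : Set (ZMod p × ZMod p)).PairwiseDisjoint fun xc => apFinset (g xc) 1 (b' + 1) := by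
    intro xc hxc xc' hxc' hne
    rw [Function.onFun, ← hφblk, ← hφblk]
    exact (Finset.disjoint_image hφinj).2 (hPdisj hxc hxc' hne)
  set S := SY.image (fun x => u * x + w) with hSdef
  have hTS : T ∪ S = apFinset 0 1 N₁ := by rw [hT, hSdef, ← Finset.image_union, hv, hφV]
  have hTSdisj : Disjoint T S := by rw [hT, hSdef]; exact (Finset.disjoint_image hφinj).2 hWV
  have hTsub : ∀ xc ∈ P, apFinset (g xc) 1 (b' + 1) ⊆ apFinset 0 1 N₁ := by
    intro xc hxc y hy'
    rw [← hTS, hTeq]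
    exact Finset.mem_union_left _ (Finset.mem_biUnion.2 ⟨xc, hxc, hy'⟩)
  have hSsub : S ⊆ apFinset 0 1 N₁ := by rw [← hTS]; exact Finset.subset_union_right
  have hN₁ : N₁ ≤ p := by omega
  refine ⟨hSsub, fun x hxS => ?_⟩
  have hxT : x ∉ T := fun hxT => Finset.disjoint_left.1 hTSdisj hxT hxS
  have hxle : x.val ≤ N₁ := ((mem_apFinset_zero_one_iff hN₁).1 (hSsub hxS)).le
  have h4 : (b' + 1) ∣ #(T.filter fun y => y.val < x.val) := by
    rw [hTeq]
    exact dvd_card_filter_val_lt_prime P g (by omega) hTdisj hTsub x (by rw [← hTeq]; exact hxT)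
  rw [(card_filter_val_lt_of_union_prime hN₁ hTS hTSdisj hxle).2] at h4
  exact h4

/-! ## The holed window with gapped tiles (case β) -/

/-- Transport of a gapped block: with `u e′ = 1`, the map `y ↦ u (c − y) + w` sends `{β + k e′ : k ≤ b, k ≠ g₁}` onto the translate by
`u (c − β − b e′) + w` of `{0,…,b} ∖ {b − g₁}` (cast into `ℤ/pℤ`). [folklore] -/
theorem image_sub_apErase_affine {u w e' β c : ZMod p} (hue : u * e' = 1) {b g₁ : ℕ} (hg₁ : g₁ ≤ b) :
    (apErase β e' (b + 1) g₁).image (fun y => u * (c - y) + w) =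
      ((range (b + 1)).erase (b - g₁)).image (fun ii : ℕ => (u * (c - β - b • e') + w) + (ii : ZMod p)) := by
  ext x
  simp only [Finset.mem_image, mem_apErase, Finset.mem_erase, Finset.mem_range]
  constructor
  · rintro ⟨y, ⟨k, hk, hkne, rfl⟩, rfl⟩
    refine ⟨b - k, ⟨by omega, by omega⟩, ?_⟩
    rw [Nat.cast_sub (by omega : k ≤ b), nsmul_eq_mul, nsmul_eq_mul]
    linear_combination ((k : ZMod p) - b) * hue
  · rintro ⟨ii, ⟨hne, hii⟩, rfl⟩
    refine ⟨β + (b - ii) • e', ⟨b - ii, by omega, by omega, rfl⟩, ?_⟩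
    rw [nsmul_eq_mul, nsmul_eq_mul, Nat.cast_sub (by omega : ii ≤ b)]
    linear_combination (ii : ZMod p) * hue

/-- **Gapped tiles in a holed window** (case β, the transport-and-table step).  `Bᵢ = {β + k e′ : k ≤ b, k ≠ g₁}` with `g₁ < b` (`b ≥ 1`,
`e′ ≠ 0`), `V = W ⊔ SY ⊆ {v + k e′ : k ≤ n}` with `|V| = n`, `SY` the `m`-term progression of step `d ≠ 0` from `c₀`, `n + 1 + b ≤ p`, at most `n + 1`
blocks; then the case-β table for `(p, n+1, m, b)` with target `J` gives `(e′⁻¹ d).val ∈ J`. [folklore] -/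
theorem holed_ratio_val_mem (hS : IsSTPP A B C) (i : Fin N) {e' β v d c₀ : ZMod p} {b g₁ n m : ℕ} (he' : e' ≠ 0) (hd : d ≠ 0)
    (hg₁ : g₁ < b) (hB : B i = apErase β e' (b + 1) g₁) {SY : Finset (ZMod p)} (hSY : SY = apFinset c₀ d m)
    (hWV : Disjoint ((((A i) ×ˢ ((B i) ×ˢ (C i))).image fun q : ZMod p × ZMod p × ZMod p => (0 : ZMod p) + q.2.2 - q.1 - q.2.1)) SY)
    (hVsub : (((A i) ×ˢ ((B i) ×ˢ (C i))).image fun q : ZMod p × ZMod p × ZMod p => (0 : ZMod p) + q.2.2 - q.1 - q.2.1) ∪ SY ⊆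
      apFinset v e' (n + 1))
    (hVcard : #((((A i) ×ˢ ((B i) ×ˢ (C i))).image fun q : ZMod p × ZMod p × ZMod p => (0 : ZMod p) + q.2.2 - q.1 - q.2.1) ∪ SY) = n)
    (hnb : n + 1 + b ≤ p) (hPcard : #((A i) ×ˢ (C i)) ≤ n + 1) {J : Finset ℕ}
    (htable : ∀ j < p, ∀ t < p, (∀ i < m, (t + j * i) % p < n + 1) → ∀ hh < n + 1, hh ∉ (range m).image (fun i => (t + j * i) % p) →
      ∀ g₀ < b, greedyTiles ((range (b + 1)).erase (g₀ + 1)) (n + 1)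
        (((range (n + 1)).erase hh).filter fun x => x ∉ (range m).image fun i => (t + j * i) % p) = true → j ∈ J) :
    (e'⁻¹ * d).val ∈ J := by
  set W := ((A i) ×ˢ ((B i) ×ˢ (C i))).image fun q : ZMod p × ZMod p × ZMod p => (0 : ZMod p) + q.2.2 - q.1 - q.2.1 with hW
  obtain ⟨hWeq0, hPdisj0⟩ := W_eq_biUnion_blocks hS i
  rw [← hW] at hWeq0
  set P := (A i) ×ˢ (C i) with hP
  -- transport
  set u : ZMod p := e'⁻¹ with hu
  set w : ZMod p := -(u * v) with hw
  have hu0 : u ≠ 0 := inv_ne_zero he'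
  have hue : u * e' = 1 := inv_mul_cancel₀ he'
  have hφinj : Function.Injective (fun x : ZMod p => u * x + w) := affine_injective hu0 w
  have hφVsup : (apFinset v e' (n + 1)).image (fun x => u * x + w) = apFinset 0 1 (n + 1) := by
    rw [image_affine_apFinset, hue, hw, add_neg_cancel]
  set G : Finset ℕ := (range (b + 1)).erase (b - g₁) with hG
  have hG0 : 0 ∈ G := Finset.mem_erase.2 ⟨by omega, Finset.mem_range.2 (by omega)⟩
  have hGsub : G ⊆ range (b + 1) := Finset.erase_subset _ _
  set gz : ZMod p × ZMod p → ZMod p := fun xc => u * ((xc.2 - xc.1) - β - b • e') + w with hgz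
  have hφblk : ∀ xc : ZMod p × ZMod p,
      ((B i).image fun y => (xc.2 - xc.1) - y).image (fun x => u * x + w) = G.image (fun ii : ℕ => gz xc + (ii : ZMod p)) := by
    intro xc
    rw [hB, Finset.image_image]
    have h := image_sub_apErase_affine (β := β) (c := xc.2 - xc.1) (w := w) hue (le_of_lt hg₁)
    exact h
  set T := W.image (fun x => u * x + w) with hT
  have hTeq : T = P.biUnion fun xc => G.image (fun ii : ℕ => gz xc + (ii : ZMod p)) := by
    rw [hT, hWeq0, Finset.biUnion_image]
    exact Finset.biUnion_congr rfl fun xc _ => hφblk xc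
  have hTdisj : (P : Set (ZMod p × ZMod p)).PairwiseDisjoint fun xc => G.image (fun ii : ℕ => gz xc + (ii : ZMod p)) := by
    intro xc hxc xc' hxc' hne
    rw [Function.onFun, ← hφblk, ← hφblk]
    exact (Finset.disjoint_image hφinj).2 (hPdisj0 hxc hxc' hne)
  set S := SY.image (fun x => u * x + w) with hSdef
  have hSeq : S = apFinset (u * c₀ + w) (u * d) m := by rw [hSdef, hSY, image_affine_apFinset]
  set I := apFinset (0 : ZMod p) 1 (n + 1) with hI
  set V' := (W ∪ SY).image (fun x => u * x + w) with hV'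
  have hV'sub : V' ⊆ I := by
    rw [hV', ← hφVsup]; exact Finset.image_subset_image hVsub
  have hV'card : #V' = n := by rw [hV', Finset.card_image_of_injective _ hφinj, hVcard]
  have hn1 : n + 1 ≤ p := by omega
  have hIcard : #I = n + 1 := card_apFinset one_ne_zero hn1
  obtain ⟨h₀, hh₀⟩ : ∃ h₀, I \ V' = {h₀} := Finset.card_eq_one.1 (by rw [Finset.card_sdiff_of_subset hV'sub, hIcard, hV'card]; omega)
  have hh₀I : h₀ ∈ I := (Finset.mem_sdiff.1 (by rw [hh₀]; exact Finset.mem_singleton_self _)).1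
  have hh₀V : h₀ ∉ V' := (Finset.mem_sdiff.1 (by rw [hh₀]; exact Finset.mem_singleton_self _)).2
  have hV'TS : V' = T ∪ S := by rw [hV', hT, hSdef, Finset.image_union]
  have hTSdisj : Disjoint T S := by rw [hT, hSdef]; exact (Finset.disjoint_image hφinj).2 hWV
  have hTI : T ⊆ I := fun x hx => hV'sub (by rw [hV'TS]; exact Finset.mem_union_left _ hx)
  have hSI : S ⊆ I := fun x hx => hV'sub (by rw [hV'TS]; exact Finset.mem_union_right _ hx)
  -- the tiles, transported to ℕ
  have hwin : ∀ xc ∈ P, ∀ ii ∈ G, gz xc + (ii : ZMod p) ∈ apFinset (0 : ZMod p) 1 (n + 1) := by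
    intro xc hxc ii hii
    apply hTI
    rw [hTeq]
    exact Finset.mem_biUnion.2 ⟨xc, hxc, Finset.mem_image.2 ⟨ii, hii, rfl⟩⟩
  obtain ⟨hTval, hdisjℕ⟩ := val_image_tiles (n := n + 1) (b := b) hnb hGsub hG0 P gz hwin hTdisj
  have hgreedy0 := greedyTiles_of_tiling G hG0 (fun xc => (gz xc).val) (n + 1) P hPcard hdisjℕ
  rw [← hTval, ← hTeq] at hgreedy0
  -- identify T.image val with the table's set
  set t' : ZMod p := u * c₀ + w with ht'
  set j' : ZMod p := u * d with hj'
  have hj'0 : j' ≠ 0 := mul_ne_zero hu0 hd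
  have hposval : ∀ k, (t' + k • j').val = (t'.val + j'.val * k) % p := fun k => val_add_nsmul_zmod t' j' k
  have hSmem : ∀ y, y ∈ S ↔ ∃ k, k < m ∧ t' + k • j' = y := by
    intro y; rw [hSeq, mem_apFinset]
  have hXeq : T.image ZMod.val =
      ((range (n + 1)).erase h₀.val).filter fun x => x ∉ (range m).image fun k => (t'.val + j'.val * k) % p := by
    ext x
    simp only [Finset.mem_image, Finset.mem_filter, Finset.mem_erase, Finset.mem_range, not_exists, not_and]
    constructor
    · rintro ⟨y, hyT, rfl⟩
      have hyI : y ∈ I := hTI hyT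
      refine ⟨⟨fun heq => hh₀V ?_, (mem_apFinset_zero_one_iff hn1).1 hyI⟩, ?_⟩
      · have hy : y = h₀ := ZMod.val_injective p heq
        rw [hV'TS, ← hy]
        exact Finset.mem_union_left _ hyT
      · intro k hk hk'
        have hyS : y ∈ S := (hSmem y).2 ⟨k, hk, ZMod.val_injective p (by rw [hposval, hk'])⟩
        exact Finset.disjoint_left.1 hTSdisj hyT hyS
    · rintro ⟨⟨hne, hlt⟩, hnot⟩
      have hxp : x < p := by omega
      have hxval : (x : ZMod p).val = x := by rw [ZMod.val_natCast, Nat.mod_eq_of_lt hxp]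
      have hxI : (x : ZMod p) ∈ I := (mem_apFinset_zero_one_iff hn1).2 (by rw [hxval]; exact hlt)
      have hxh : (x : ZMod p) ≠ h₀ := fun h => hne (by rw [← h, hxval])
      have hxV' : (x : ZMod p) ∈ V' := by
        by_contra hxV'
        have : (x : ZMod p) ∈ I \ V' := Finset.mem_sdiff.2 ⟨hxI, hxV'⟩
        rw [hh₀, Finset.mem_singleton] at this
        exact hxh this
      rw [hV'TS, Finset.mem_union] at hxV'
      rcases hxV' with hxT | hxS
      · exact ⟨(x : ZMod p), hxT, hxval⟩
      · exfalso
        obtain ⟨k, hk, hkx⟩ := (hSmem _).1 hxS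
        exact hnot k hk (by rw [← hposval, hkx, hxval])
  rw [hXeq] at hgreedy0
  -- table
  have hwinS : ∀ k < m, (t'.val + j'.val * k) % p < n + 1 := by
    intro k hk
    rw [← hposval]
    exact (mem_apFinset_zero_one_iff hn1).1 (hSI ((hSmem _).2 ⟨k, hk, rfl⟩))
  have hh₀lt : h₀.val < n + 1 := (mem_apFinset_zero_one_iff hn1).1 hh₀I
  have hhole : h₀.val ∉ (range m).image fun k => (t'.val + j'.val * k) % p := by
    intro hmem
    obtain ⟨k, hk, hkx⟩ := Finset.mem_image.1 hmem
    have hmem' : h₀ ∈ S := (hSmem _).2 ⟨k, Finset.mem_range.1 hk, ZMod.val_injective p (by rw [hposval, hkx])⟩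
    exact hh₀V (by rw [hV'TS]; exact Finset.mem_union_right _ hmem')
  obtain ⟨g₀, hg₀⟩ : ∃ g₀, b - g₁ = g₀ + 1 := ⟨b - g₁ - 1, by omega⟩
  have hg₀b : g₀ < b := by omega
  rw [hG, hg₀] at hgreedy0
  have hval := htable j'.val (ZMod.val_lt j') t'.val (ZMod.val_lt t') hwinS h₀.val hh₀lt hhole g₀ hg₀b hgreedy0
  rw [hj'] at hval
  exact hval

end Summit.MatrixMultiplication.OmegaCensus.CubeNB
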